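import Literature.AlgebraicGeometry.ModuliOfAbelianVarieties.SiegelPointOfFramedTorus
import Literature.AlgebraicGeometry.HodgeTheory.ComplexTorusLatticeCoordinatesHodge
import HarnessLib

/-!
# Hodge periods in canonical lattice coordinates ARE torus periods; the Siegel point of a Hodge frame
# (U-e P4 road step (c)/(e) seam, per fibre — census (L5) / (b4) core)

Topic `AlgebraicGeometry/ModuliOfAbelianVarieties`; namespace `Literature.AlgebraicGeometry.ModuliOfAbelianVarieties`.
KERNEL ONLY: theorems; no definition, no named fact, no instance, no `sorry`.  Cell `hodgecm-mathlib` (D-0151),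
rung-0 (U)-road, U-e socket P4, census round 2 `CENSUS-Ue-P4-round2` (B-p05 (g13)) item (L5) = the per-fibre core of
(b4): for an ALGEBRAIC complex torus — a smooth projective `X/ℂ` analytified by `φ : E/Φ(ℤ^ι) → X(ℂ)` — and any
linearly independent family `w₁, …, w_g` (`g = dim_ℂ E`) of `(1,0)`-classes in `ℂ ⊗_ℚ H¹(X(ℂ); ℚ)`, the `g × ι`
matrix of their CANONICAL LATTICE COORDINATES (★ `latticeCoordHOne Φ ∘ φ^*`) IS a period matrix of the torus
(★ `ComplexTorus.periodMatrix c Φ`) for a suitable `ℂ`-basis `c` of `E` (the basis dual to the `ℂ`-linear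
functionals whose period rows are the `wᵢ`, ★ `complexTorus_latticeCoordHOne_hodgeOneZero_holds`); hence, by ★
`SiegelPointOfFramedTorus`, the type-`δ` normalisation `Δ · P_μ⁻¹ · P_λ` of the Hodge-frame matrix `P` is the Siegel
point of the framed torus and defines its marking `[J(Δ P_μ⁻¹ P_λ), r]`.  In the family (b4) instantiates this at every
fibre with `w :=` the Griffiths frame (★ p712353) read in transported lattice coordinates.  HC_CM is proved only modulo
the 7 printed citations until rung 0 closes; nothing here changes that count (books 0).

PRINT. [Lange2023AbelianVarietiesComplex] §1.1.3 Lemma 1.1.17 (a), Cor. 1.1.19 (p. 14), §1.1.4 Prop. 1.1.20 (p. 15) and §1.1.5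
Thm. 1.1.21 (b) (p. 15):
`H¹(X, ℤ) = Hom(Λ, ℤ)`, `H¹(X, ℂ) = Hom_ℝ(V, ℂ)`, `H^{1,0}(X) = Hom_ℂ(V, ℂ)` — so a basis of `H^{1,0}` written in the
coordinates dual to a lattice basis is the period matrix of `X` for the dual basis of `V` (§1.1.1 «`Π = (λⱼᵢ)` … is
called a period matrix for `X`»); [LangeBirkenhake1992] §8.1 Prop. 8.1.1 (normal form `(Z, D)`).  [VoisinHodgeI2002] §7.2.2 (Hodge structure
of a torus) and §10.1.2 Thm. 10.9 (the period map is holomorphic).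

* `exists_basis_periodMatrix_eq_latticeCoord` — THE (L5) IDENTITY: `∃ c, periodMatrix c Φ i a = (coordinates of wᵢ)ₐ`.
* `siegelPoint_eq_of_hodgeFrame_of_apply_jOfSiegel` — with the marking clause `Φ (J_Z x) = i·Φ x` (`Z ∈ 𝔥_g`,
  `ι = Fin g ⊕ Fin g`): `P_μ` is invertible and `Z = Δ P_μ⁻¹ P_λ` (★ `SiegelModuli.siegelPoint_eq_of_apply_jOfSiegel`).
* `exists_siegelAdelicMarking_of_hodgeFrame` — with a Riemann form whose lattice Gram matrix is `E_δ`: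
  `Δ P_μ⁻¹ P_λ ∈ 𝔥_g` and the uniformised abelian variety is marked by `[J(Δ P_μ⁻¹ P_λ), r]` for every `r ∈ K_δ(1)`
  with `Ψ = Φ`, `toFun = φ`, `m.r v = φ [ṽ]` (★ `exists_siegelAdelicMarking_of_latticeGram_eq_typeForm`).

## References
* [Lange2023AbelianVarietiesComplex] H. Lange, *Abelian Varieties over the Complex Numbers* (2023), §1.1.1 (period matrix),
  §1.1.3 Lemma 1.1.17 (a) and Cor. 1.1.19 (p. 14), §1.1.4 Prop. 1.1.20 (p. 15), §1.1.5 Thm. 1.1.21 (b) (p. 15).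
* [LangeBirkenhake1992] H. Lange, Ch. Birkenhake, *Complex Abelian Varieties* (1992), §8.1 Prop. 8.1.1.
* [VoisinHodgeI2002] C. Voisin, *Hodge Theory and Complex Algebraic Geometry I* (2002), §7.2.2 and §10.1.2 Thm. 10.9.
* [Milne2005ShimuraVarieties] J. S. Milne, *Introduction to Shimura Varieties* (2005), §6 Thm. 6.11 pp. 74–75.
-/

set_option autoImplicit false

noncomputable section

open scoped TensorProduct Manifold ContDiff Matrix
open CategoryTheory Matrix Complex Module
open Literature.AlgebraicTopology.SingularHomology (singularCohomology)
open Literature.NumberTheory.Transcendental (IsAnalytification)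
open Literature.Geometry.Kaehler Literature.Geometry.Kaehler.ComplexTorus
open Literature.AlgebraicGeometry.Motives (ComplexPoints IsSmoothProjective ofRatClassBaseChange SchemeOver
  AbelianVariety)
open Literature.AlgebraicGeometry.HodgeTheory

namespace Literature.AlgebraicGeometry.ModuliOfAbelianVarieties

open Literature.NumberTheory.Automorphic (siegelUpperHalfSpace)
open SiegelModuli

/-! ### §1 The identity: Hodge periods in canonical lattice coordinates = torus periods -/

section Identity

variable {ι : Type} [Fintype ι] [DecidableEq ι] {E : Type} [NormedAddCommGroup E] [NormedSpace ℂ E]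
  [FiniteDimensional ℂ E]

/-- **HODGE PERIODS IN CANONICAL LATTICE COORDINATES ARE TORUS PERIODS** ([Lange2023AbelianVarietiesComplex] Thm. 1.1.21 (b)
with Lemma 1.1.17 (a) / Cor. 1.1.19: `H^{1,0}(X) = Hom_ℂ(V, ℂ) ⊂ Hom(Λ, ℤ) ⊗ ℂ = H¹(X, ℂ)`).  Let the smooth projective
`X/ℂ` of dimension `n` be analytified by the complex torus `E/Φ(ℤ^ι)` via `φ`, and let `w₁, …, w_g`, `g = dim_ℂ E`, be
`ℂ`-linearly independent classes of `ℂ ⊗_ℚ H¹(X(ℂ); ℚ)` of Hodge type `(1,0)` (a Hodge frame of `F¹H¹(X)`).  Then there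
is a `ℂ`-basis `c` of `E` whose torus period matrix (★ `ComplexTorus.periodMatrix c Φ`: `c`-coordinates of the lattice
vectors `Φ eₐ`) IS the matrix of canonical lattice coordinates of the frame:
`periodMatrix c Φ i a = ((latticeCoordHOne Φ ∘ φ^*) ⊗ ℂ) (wᵢ)ₐ`.  Proof: by ★
`complexTorus_latticeCoordHOne_hodgeOneZero_holds` each coordinate row is the period row of a unique `ℂ`-linear
functional `ℓᵢ` (★ `mem_hodgeOneZeroRows_iff`); the `ℓᵢ` are independent (★ `dualPeriodRow` is `ℂ`-linear, `φ^*` an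
isomorphism, ★ `singularCohomology.mapIso`), hence a basis of the dual (`dim = g`); `c` is its dual basis, and
`c.repr (Φ eₐ) i = ℓᵢ (Φ eₐ)` is the `(i, a)` period (★ `piScalarRight_periodRow`).
[cite: Lange2023AbelianVarietiesComplex, §1.1.5 Thm. 1.1.21 (b) (p. 15), §1.1.3 Lemma 1.1.17 (a) and Cor. 1.1.19 (p. 14), §1.1.1]
[cite: VoisinHodgeI2002, §7.2.2] -/
theorem exists_basis_periodMatrix_eq_latticeCoord (Φ : (ι → ℝ) ≃L[ℝ] E) {n : ℕ} {X : SchemeOver ℂ}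
    (hX : IsSmoothProjective n X) (φ : C(ComplexTorus Φ, ComplexPoints X)) (hφ : IsAnalytification E X n φ)
    {g : ℕ} (hg : Module.finrank ℂ E = g)
    (w : Fin g → ℂ ⊗[ℚ] singularCohomology ℚ ℚ (ComplexPoints X) 1)
    (hw : ∀ i, IsOfHodgeType n X 1 1 0 (ofRatClassBaseChange (ComplexPoints X) 1 (w i)))
    (hli : LinearIndependent ℂ w) :
    ∃ c : Basis (Fin g) ℂ E, ∀ i a,
      periodMatrix c Φ i a =
        TensorProduct.piScalarRight ℚ ℂ ℂ ι
          (((latticeCoordHOne Φ).toLinearMap ∘ₗ (singularCohomology.map ℚ ℚ φ 1).hom).baseChange ℂ (w i)) a := by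
  classical
  -- abbreviation: the canonical lattice coordinates, complexified
  set κ : ℂ ⊗[ℚ] singularCohomology ℚ ℚ (ComplexPoints X) 1 →ₗ[ℂ] ℂ ⊗[ℚ] (ι → ℚ) :=
    ((latticeCoordHOne Φ).toLinearMap ∘ₗ (singularCohomology.map ℚ ℚ φ 1).hom).baseChange ℂ with hκ
  -- (1) each coordinate row is the period row of a `ℂ`-linear functional
  have hrow : ∀ i, ∃ ℓ : E →L[ℂ] ℂ, dualPeriodRow Φ ℓ = κ (w i) := fun i => by
    have hmem : κ (w i) ∈ hodgeOneZeroRows Φ :=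
      (complexTorus_latticeCoordHOne_hodgeOneZero_holds Φ hX φ hφ (w i)).1 (hw i)
    obtain ⟨ℓ, hℓ⟩ := (mem_hodgeOneZeroRows_iff Φ _).1 hmem
    exact ⟨ℓ, by rw [dualPeriodRow_apply, hℓ]⟩
  choose ℓ hℓ using hrow
  -- (2) `κ` is injective: `φ^*` is an isomorphism (φ a homeomorphism), `latticeCoordHOne` an equivalence
  have hcoe : ((hφ.isHomeomorph.homeomorph φ : ComplexTorus Φ ≃ₜ ComplexPoints X) :
      C(ComplexTorus Φ, ComplexPoints X)) = φ := ContinuousMap.ext fun _ => rfl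
  let eφ : singularCohomology ℚ ℚ (ComplexPoints X) 1 ≃ₗ[ℚ] singularCohomology ℚ ℚ (ComplexTorus Φ) 1 :=
    (singularCohomology.mapIso ℚ ℚ (hφ.isHomeomorph.homeomorph φ) 1).toLinearEquiv
  have heφ : ∀ y, eφ y = (singularCohomology.map ℚ ℚ φ 1).hom y := by
    intro y
    change (singularCohomology.mapIso ℚ ℚ (hφ.isHomeomorph.homeomorph φ) 1).hom y = _
    rw [singularCohomology.mapIso_hom, hcoe]
  let cq : singularCohomology ℚ ℚ (ComplexPoints X) 1 ≃ₗ[ℚ] (ι → ℚ) := eφ.trans (latticeCoordHOne Φ)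
  have hcq : cq.toLinearMap = (latticeCoordHOne Φ).toLinearMap ∘ₗ (singularCohomology.map ℚ ℚ φ 1).hom := by
    refine LinearMap.ext fun y => ?_
    change latticeCoordHOne Φ (eφ y) = latticeCoordHOne Φ ((singularCohomology.map ℚ ℚ φ 1).hom y)
    rw [heφ]
  have hκeq : κ = (cq.baseChange ℚ ℂ _ _ : ℂ ⊗[ℚ] _ ≃ₗ[ℂ] ℂ ⊗[ℚ] (ι → ℚ)).toLinearMap := by
    rw [hκ, ← hcq]; rfl
  have hκinj : Function.Injective κ := by
    rw [hκeq]; exact (cq.baseChange ℚ ℂ _ _).injective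
  -- (3) the functionals `ℓᵢ` are `ℂ`-linearly independent
  have hℓli : LinearIndependent ℂ (fun i => ((ℓ i : E →L[ℂ] ℂ) : Module.Dual ℂ E)) := by
    rw [Fintype.linearIndependent_iff]
    intro s hs
    have h1 : ∑ i, s i • dualPeriodRow Φ (ℓ i) = 0 := by
      have h2 : dualPeriodRow Φ (∑ i, s i • ℓ i) = 0 := by
        have h3 : (∑ i, s i • ℓ i : E →L[ℂ] ℂ) = 0 := by
          apply ContinuousLinearMap.coe_injective
          rw [ContinuousLinearMap.toLinearMap_sum, ContinuousLinearMap.toLinearMap_zero]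
          simpa only [ContinuousLinearMap.toLinearMap_smul] using hs
        rw [h3, map_zero]
      simpa only [map_sum, map_smul] using h2
    have h4 : κ (∑ i, s i • w i) = 0 := by
      rw [map_sum]
      simpa only [map_smul, hℓ] using h1
    have h5 : ∑ i, s i • w i = 0 := hκinj (by rw [h4, map_zero])
    exact (Fintype.linearIndependent_iff.1 hli) s h5
  -- (4) they form a basis of the dual; `c` := the dual basis of `E`
  have hcard : Fintype.card (Fin g) = Module.finrank ℂ (Module.Dual ℂ E) := by
    rw [Fintype.card_fin, Subspace.dual_finrank_eq, hg]
  let bD : Basis (Fin g) ℂ (Module.Dual ℂ E) :=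
    basisOfLinearIndependentOfCardEqFinrank' _ hℓli hcard
  have hbD : ∀ i, bD i = ((ℓ i : E →L[ℂ] ℂ) : Module.Dual ℂ E) := fun i =>
    congrFun (coe_basisOfLinearIndependentOfCardEqFinrank' _ hℓli hcard) i
  let c : Basis (Fin g) ℂ E := bD.dualBasis.map (Module.evalEquiv ℂ E).symm
  have hc : ∀ v i, c.repr v i = ℓ i v := by
    intro v i
    change (bD.dualBasis.repr ((Module.evalEquiv ℂ E).symm.symm v)) i = _
    rw [LinearEquiv.symm_symm, Module.Basis.dualBasis_repr, hbD, Module.evalEquiv_apply, Module.Dual.eval_apply]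
    rfl
  refine ⟨c, fun i a => ?_⟩
  rw [periodMatrix_apply, hc, ← hℓ i, dualPeriodRow_apply, piScalarRight_periodRow]
  rfl

end Identity

/-! ### §2 The Siegel point and the marking of a Hodge frame (type `δ`, `ι = Fin g ⊕ Fin g`) -/

section Siegel

variable {g : ℕ} {δ : Fin g → ℕ} {E : Type} [NormedAddCommGroup E] [NormedSpace ℂ E] [FiniteDimensional ℂ E]

/-- **THE SIEGEL POINT OF A MARKING, READ OFF A HODGE FRAME** (U-e P4 (b4) at one fibre): if the period isomorphism
`Φ : ℝ^{2g} ≃ E` of the analytifying torus of `X` is `ℂ`-linear for `J_Z` (`Z ∈ 𝔥_g`; the `Ψ_J` clause of a T1′ marking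
by `[J(Z), a]`), then for every Hodge frame `w` of `F¹H¹(X)` with canonical lattice coordinate matrix `P`
(`P i a = ((latticeCoordHOne Φ ∘ φ^*) ⊗ ℂ)(wᵢ)ₐ`), the `μ`-block `P_μ` is invertible and `Z = Δ · P_μ⁻¹ · P_λ`
(★ `exists_basis_periodMatrix_eq_latticeCoord` + ★ `SiegelModuli.siegelPoint_eq_of_apply_jOfSiegel`).
[cite: LangeBirkenhake1992, §8.1 Prop. 8.1.1] [cite: Lange2023AbelianVarietiesComplex, §1.1.5 Thm. 1.1.21 (b) (p. 15)] [cite: VoisinHodgeI2002, §10.1.2 Thm. 10.9] -/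
theorem siegelPoint_eq_of_hodgeFrame_of_apply_jOfSiegel (hδ : ∀ i, 0 < δ i) {Z : Matrix (Fin g) (Fin g) ℂ}
    (hZ : Z ∈ siegelUpperHalfSpace g) (Φ : (Fin g ⊕ Fin g → ℝ) ≃L[ℝ] E)
    (hJ : ∀ x, Φ (jOfSiegel δ Z *ᵥ x) = Complex.I • Φ x) {n : ℕ} {X : SchemeOver ℂ}
    (hX : IsSmoothProjective n X) (φ : C(ComplexTorus Φ, ComplexPoints X)) (hφ : IsAnalytification E X n φ)
    (hg : Module.finrank ℂ E = g) (w : Fin g → ℂ ⊗[ℚ] singularCohomology ℚ ℚ (ComplexPoints X) 1)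
    (hw : ∀ i, IsOfHodgeType n X 1 1 0 (ofRatClassBaseChange (ComplexPoints X) 1 (w i)))
    (hli : LinearIndependent ℂ w) {P : Matrix (Fin g) (Fin g ⊕ Fin g) ℂ}
    (hP : ∀ i a, P i a = TensorProduct.piScalarRight ℚ ℂ ℂ (Fin g ⊕ Fin g)
      (((latticeCoordHOne Φ).toLinearMap ∘ₗ (singularCohomology.map ℚ ℚ φ 1).hom).baseChange ℂ (w i)) a) :
    IsUnit P.toCols₂.det ∧ Z = Matrix.diagonal (fun i ↦ (δ i : ℂ)) * (P.toCols₂)⁻¹ * P.toCols₁ := by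
  obtain ⟨c, hc⟩ := exists_basis_periodMatrix_eq_latticeCoord Φ hX φ hφ hg w hw hli
  have hPc : P = periodMatrix c Φ := by
    ext i a; rw [hP, hc]
  rw [hPc]
  exact siegelPoint_eq_of_apply_jOfSiegel hδ hZ Φ hJ c

/-- **THE MARKING `[J(Δ P_μ⁻¹ P_λ), r]` OF A HODGE FRAME** (U-e P4 (b3)+(b4) at one fibre): for a complex abelian variety
`A` additively analytified by `φ : ℝ^{2g}/ℤ^{2g} → A(ℂ)` (complex chart `Φ : ℝ^{2g} ≃ ℂ^g`) with a Riemann form `η`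
whose lattice frame is symplectic of type `δ` (`latticeGram Φ η = E_δ`), every Hodge frame `w` of `F¹H¹(A)` with
canonical lattice coordinate matrix `P`, and every `r ∈ K_δ(1)`: `P_μ` is invertible, `Z := Δ P_μ⁻¹ P_λ ∈ 𝔥_g`, and
`A` is marked by `[J(Z), r]` with `γ = 1`, `Ψ = Φ`, `toFun = φ`, `m.r v = φ [ṽ]`
(★ `exists_basis_periodMatrix_eq_latticeCoord` + ★ `siegelPoint_of_latticeGram_eq_typeForm` + ★
`exists_siegelAdelicMarking_of_latticeGram_eq_typeForm`).
[cite: Milne2005ShimuraVarieties, §6 Thm. 6.11 pp. 74–75] [cite: LangeBirkenhake1992, §8.1 Prop. 8.1.1] [cite: Lange2023AbelianVarietiesComplex, §1.1.5 Thm. 1.1.21 (b) (p. 15)] -/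
theorem exists_siegelAdelicMarking_of_hodgeFrame (A : AbelianVariety ℂ) (hA : IsSmoothProjective A.dim A.X)
    {Φ : (Fin g ⊕ Fin g → ℝ) ≃L[ℝ] (Fin g → ℂ)} (φ : C(ComplexTorus Φ, ComplexPoints A.X))
    (hφ : IsAnalytification (Fin g → ℂ) A.X A.dim φ) (hadd : ∀ x y, φ (x + y) = φ x * φ y)
    {η : (Fin g → ℂ) [⋀^Fin 2]→L[ℝ] ℝ} (hη : IsRiemannForm Φ η) (hδ : ∀ i, 0 < δ i)
    (hgram : latticeGram Φ η = (typeForm δ).map (Int.cast : ℤ → ℝ))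
    (w : Fin g → ℂ ⊗[ℚ] singularCohomology ℚ ℚ (ComplexPoints A.X) 1)
    (hw : ∀ i, IsOfHodgeType A.dim A.X 1 1 0 (ofRatClassBaseChange (ComplexPoints A.X) 1 (w i)))
    (hli : LinearIndependent ℂ w) {P : Matrix (Fin g) (Fin g ⊕ Fin g) ℂ}
    (hP : ∀ i a, P i a = TensorProduct.piScalarRight ℚ ℂ ℂ (Fin g ⊕ Fin g)
      (((latticeCoordHOne Φ).toLinearMap ∘ₗ (singularCohomology.map ℚ ℚ φ 1).hom).baseChange ℂ (w i)) a)
    {r : gspFinAdelic δ} (hr : r ∈ principalLevelSubgroup δ 1) :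
    IsUnit P.toCols₂.det ∧
    ∃ (hZ : Matrix.diagonal (fun i ↦ (δ i : ℂ)) * (P.toCols₂)⁻¹ * P.toCols₁ ∈ siegelUpperHalfSpace g)
      (m : SiegelAdelicMarking ⟨jOfSiegel δ _, SiegelComplexRecordSystem.jOfSiegel_mem_C0pm hδ hZ⟩ r A),
      m.γ = 1 ∧ m.Ψ = Φ ∧ (∀ x, m.toFun x = φ x) ∧
        ∀ v : Fin g ⊕ Fin g → ℚ, m.r v = φ (ComplexTorus.proj Φ fun i => (v i : ℝ)) := by
  have hg : Module.finrank ℂ (Fin g → ℂ) = g := by simp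
  obtain ⟨c, hc⟩ := exists_basis_periodMatrix_eq_latticeCoord Φ hA φ hφ hg w hw hli
  have hPc : P = periodMatrix c Φ := by
    ext i a; rw [hP, hc]
  rw [hPc]
  obtain ⟨hunit, -⟩ := siegelPoint_of_latticeGram_eq_typeForm Φ hη hδ hgram c
  exact ⟨hunit, exists_siegelAdelicMarking_of_latticeGram_eq_typeForm A (φ : ComplexTorus Φ → ComplexPoints A.X)
    hφ hadd hη hδ hgram c hr⟩

end Siegel

end Literature.AlgebraicGeometry.ModuliOfAbelianVarieties

end
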